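import Mathlib

/-!
# The wedge-order sign of the local product formula (T3.1, R-A(c); seat t3-p1 g5)

Bergeron–Millson–Moeglin, *The Hodge conjecture and arithmetic quotients of complex balls*,
Acta Math. 216 (2016), print the local product formula (Prop. C.10, p. 120) as
`(B_{V₊⊗W} ⊗ 1)(ψ_{0,q} ∧ ψ_{q,0}) = 2^q φ_{q,q}`, while the held author copy (arXiv:1306.1515,
Prop. 92) prints the other order, `ψ_{q,0} ∧ ψ_{0,q}`.  The two differ by the graded sign
`(−1)^{q·q} = (−1)^q` of swapping two forms of degree `q`; at the route's `q = 1` this is a sign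
`−1`.  The route's instance is the `(2,2)`-cocycle of FOUR line-forms — `n = 2` blocks, each a
holomorphic and an anti-holomorphic line-form — so the order convention enters once per block,
and with an EVEN number of blocks it drops out: both printed orders give the same
`(B ⊗ 1)(ψ_{2,2}) = −4 φ_{2,2}`.

This file records exactly that in Mathlib's `ExteriorAlgebra R M` (`R` any commutative ring,
`M` any `R`-module); nothing here is specific to theta series.

* `ι_mul_ιMulti`, `ιMulti_mul_ιMulti_comm` — graded commutativity of wedges of vectors:
  `(v₀ ∧ ⋯ ∧ v_{m-1}) ∧ (w₀ ∧ ⋯ ∧ w_{n-1}) = (−1)^{mn} (w₀ ∧ ⋯ ∧ w_{n-1}) ∧ (v₀ ∧ ⋯ ∧ v_{m-1})`;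
* `mul_comm_of_mem_exteriorPower` — the same for arbitrary `x ∈ ⋀[R]^m M`, `y ∈ ⋀[R]^n M`
  (by linearity from `ExteriorAlgebra.ιMulti_span_fixedDegree`);
* `neg_one_pow_mul_self`, `ιMulti_mul_ιMulti_comm_self`, `mul_comm_of_mem_exteriorPower_self` —
  `(−1)^{q·q} = (−1)^q`: the sign between the two printed orders of the `q`-fold line-forms;
* `ιMulti_mul_ιMulti_eq_blocks` — regrouping `n` holomorphic and `n` anti-holomorphic
  line-forms into `n` blocks `(a_i ∧ b_i)` costs `(−1)^{n choose 2}` (at `n = 2`: the sign `−1`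
  of `(a ∧ c) ∧ (b ∧ d) = −(a ∧ b) ∧ (c ∧ d)`, `reorder_four`);
* `map_ιMulti_mul_ιMulti_of_blocks` — for an algebra hom `B` (the intertwiner commutes with the
  outer exterior product) sending each block to `(2 s) • φ_i`, with `s = ±1` the order convention,
  `B(ψ_{n,0} ∧ ψ_{0,n}) = (−1)^{n choose 2} (2 s)^n • (φ_0 ⋯ φ_{n-1})`;
* `map_four_of_blocks`, `map_four_of_author_order`, `map_four_of_print_order` — the route's
  `n = 2`: `B((a ∧ c) ∧ (b ∧ d)) = −4 • (φ₁ φ₂)` whichever order the formula is printed in.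
-/

set_option autoImplicit false

namespace HodgeRepro.T3P1.WedgeReorder

open ExteriorAlgebra

variable {R : Type*} [CommRing R] {M : Type*} [AddCommGroup M] [Module R M]

/-- Two degree-one elements of the exterior algebra anticommute. -/
theorem ι_mul_ι_swap (x y : M) : ι R x * ι R y = -(ι R y * ι R x) :=
  eq_neg_of_add_eq_zero_left (ι_add_mul_swap x y)

/-- A vector commutes with a wedge of `n` vectors up to the sign `(−1)^n`. -/
theorem ι_mul_ιMulti (x : M) {n : ℕ} (v : Fin n → M) :
    ι R x * ιMulti R n v = (-1 : R) ^ n • (ιMulti R n v * ι R x) := by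
  induction n with
  | zero => simp
  | succ n ih =>
    rw [ιMulti_succ_apply]
    calc ι R x * (ι R (v 0) * ιMulti R n (Matrix.vecTail v))
        = (ι R x * ι R (v 0)) * ιMulti R n (Matrix.vecTail v) := by rw [mul_assoc]
      _ = -(ι R (v 0) * (ι R x * ιMulti R n (Matrix.vecTail v))) := by
          rw [ι_mul_ι_swap, neg_mul, mul_assoc]
      _ = -(ι R (v 0) * ((-1 : R) ^ n • (ιMulti R n (Matrix.vecTail v) * ι R x))) := by rw [ih]
      _ = (-1 : R) ^ (n + 1) • (ι R (v 0) * ιMulti R n (Matrix.vecTail v) * ι R x) := by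
          rw [mul_smul_comm, ← neg_smul, pow_succ, mul_neg_one, mul_assoc]

/-- A wedge of `n` vectors commutes with a vector up to the sign `(−1)^n`. -/
theorem ιMulti_mul_ι {n : ℕ} (v : Fin n → M) (x : M) :
    ιMulti R n v * ι R x = (-1 : R) ^ n • (ι R x * ιMulti R n v) := by
  rw [ι_mul_ιMulti, smul_smul, ← pow_add, ← two_mul, (even_two_mul n).neg_one_pow, one_smul]

/-- Graded commutativity for wedges of vectors: an `m`-fold wedge and an `n`-fold wedge commute
up to the sign `(−1)^{mn}`. -/
theorem ιMulti_mul_ιMulti_comm {m n : ℕ} (v : Fin m → M) (w : Fin n → M) :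
    ιMulti R m v * ιMulti R n w = (-1 : R) ^ (m * n) • (ιMulti R n w * ιMulti R m v) := by
  induction m with
  | zero => simp
  | succ m ih =>
    rw [ιMulti_succ_apply]
    calc ι R (v 0) * ιMulti R m (Matrix.vecTail v) * ιMulti R n w
        = ι R (v 0) * (ιMulti R m (Matrix.vecTail v) * ιMulti R n w) := by rw [mul_assoc]
      _ = (-1 : R) ^ (m * n) • ((ι R (v 0) * ιMulti R n w) * ιMulti R m (Matrix.vecTail v)) := by
          rw [ih, mul_smul_comm, mul_assoc]
      _ = (-1 : R) ^ (m * n) •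
            (((-1 : R) ^ n • (ιMulti R n w * ι R (v 0))) * ιMulti R m (Matrix.vecTail v)) := by
          rw [ι_mul_ιMulti]
      _ = (-1 : R) ^ ((m + 1) * n) •
            (ιMulti R n w * (ι R (v 0) * ιMulti R m (Matrix.vecTail v))) := by
          rw [smul_mul_assoc, smul_smul, ← pow_add, mul_assoc, add_mul, one_mul]

/-- Graded commutativity of the exterior algebra: `x ∈ ⋀[R]^m M` and `y ∈ ⋀[R]^n M` satisfy
`x * y = (−1)^{mn} • (y * x)`. -/
theorem mul_comm_of_mem_exteriorPower {m n : ℕ} {x y : ExteriorAlgebra R M}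
    (hx : x ∈ ⋀[R]^m M) (hy : y ∈ ⋀[R]^n M) :
    x * y = (-1 : R) ^ (m * n) • (y * x) := by
  rw [← ιMulti_span_fixedDegree] at hx hy
  induction hx using Submodule.span_induction with
  | mem x hx =>
    obtain ⟨v, rfl⟩ := hx
    induction hy using Submodule.span_induction with
    | mem y hy =>
      obtain ⟨w, rfl⟩ := hy
      exact ιMulti_mul_ιMulti_comm v w
    | zero => simp
    | add y z _ _ hy hz => rw [mul_add, add_mul, hy, hz, smul_add]
    | smul r y _ hy => rw [mul_smul_comm, smul_mul_assoc, hy, smul_comm]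
  | zero => simp
  | add x z _ _ hx hz => rw [add_mul, mul_add, hx, hz, smul_add]
  | smul r x _ hx => rw [smul_mul_assoc, mul_smul_comm, hx, smul_comm]

/-- `(−1)^{q·q} = (−1)^q`. -/
theorem neg_one_pow_mul_self (q : ℕ) : (-1 : R) ^ (q * q) = (-1) ^ q :=
  neg_one_pow_congr (by rw [Nat.even_mul, or_self])

/-- The two printed orders of the local product formula differ by `(−1)^q`: for two `q`-fold
wedges of vectors, `ψ_{0,q} ∧ ψ_{q,0} = (−1)^q • (ψ_{q,0} ∧ ψ_{0,q})`; at `q = 1` a sign `−1`. -/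
theorem ιMulti_mul_ιMulti_comm_self {q : ℕ} (v w : Fin q → M) :
    ιMulti R q v * ιMulti R q w = (-1 : R) ^ q • (ιMulti R q w * ιMulti R q v) := by
  rw [ιMulti_mul_ιMulti_comm, neg_one_pow_mul_self]

/-- The same for arbitrary elements of `⋀[R]^q M`. -/
theorem mul_comm_of_mem_exteriorPower_self {q : ℕ} {x y : ExteriorAlgebra R M}
    (hx : x ∈ ⋀[R]^q M) (hy : y ∈ ⋀[R]^q M) :
    x * y = (-1 : R) ^ q • (y * x) := by
  rw [mul_comm_of_mem_exteriorPower hx hy, neg_one_pow_mul_self]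

/-- Regrouping `n` holomorphic line-forms `a_i` and `n` anti-holomorphic line-forms `b_i` into
`n` blocks `(a_i ∧ b_i)` costs the sign `(−1)^{n choose 2}`:
`(a₀ ∧ ⋯ ∧ a_{n-1}) ∧ (b₀ ∧ ⋯ ∧ b_{n-1}) = (−1)^{n choose 2} • (a₀ ∧ b₀) ∧ ⋯ ∧ (a_{n-1} ∧ b_{n-1})`. -/
theorem ιMulti_mul_ιMulti_eq_blocks {n : ℕ} (a b : Fin n → M) :
    ιMulti R n a * ιMulti R n b
      = (-1 : R) ^ (n.choose 2) • (List.ofFn fun i => ι R (a i) * ι R (b i)).prod := by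
  induction n with
  | zero => simp
  | succ n ih =>
    rw [ιMulti_succ_apply, ιMulti_succ_apply, List.ofFn_succ, List.prod_cons]
    calc ι R (a 0) * ιMulti R n (Matrix.vecTail a) * (ι R (b 0) * ιMulti R n (Matrix.vecTail b))
        = ι R (a 0) * (ιMulti R n (Matrix.vecTail a) * ι R (b 0)) *
            ιMulti R n (Matrix.vecTail b) := by simp only [mul_assoc]
      _ = (-1 : R) ^ n • ((ι R (a 0) * ι R (b 0)) *
            (ιMulti R n (Matrix.vecTail a) * ιMulti R n (Matrix.vecTail b))) := by
          rw [ιMulti_mul_ι, mul_smul_comm, smul_mul_assoc]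
          simp only [mul_assoc]
      _ = (-1 : R) ^ n • ((ι R (a 0) * ι R (b 0)) * ((-1 : R) ^ (n.choose 2) •
            (List.ofFn fun i => ι R (Matrix.vecTail a i) * ι R (Matrix.vecTail b i)).prod)) := by
          rw [ih]
      _ = (-1 : R) ^ ((n + 1).choose 2) •
            (ι R (a 0) * ι R (b 0) * (List.ofFn fun i => ι R (a i.succ) * ι R (b i.succ)).prod) := by
          rw [mul_smul_comm, smul_smul, ← pow_add, Nat.choose_succ_succ' n 1, Nat.choose_one_right]
          rfl

/-- The route's instance `n = 2`: regrouping four odd line-forms,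
`(a ∧ c) ∧ (b ∧ d) = −((a ∧ b) ∧ (c ∧ d))` — `a, c` the two `(1,0)`-forms, `b, d` the two
`(0,1)`-forms; the sign between `ψ_{2,0} ∧ ψ_{0,2}` and the product of the two `(1,1)`-blocks. -/
theorem reorder_four (a b c d : M) :
    (ι R a * ι R c) * (ι R b * ι R d) = -((ι R a * ι R b) * (ι R c * ι R d)) := by
  have h := ιMulti_mul_ιMulti_eq_blocks (R := R) ![a, c] ![b, d]
  simp only [ιMulti_succ_apply, ιMulti_zero_apply, Matrix.vecTail, Function.comp_def,
    Fin.succ_zero_eq_one, Matrix.cons_val_zero, Matrix.cons_val_one,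
    List.ofFn_succ, List.ofFn_zero, List.prod_cons, List.prod_nil, mul_one,
    Nat.choose_self, pow_one, neg_one_smul] at h
  simpa only [mul_one] using h

section blocks

variable {A : Type*} [Ring A] [Algebra R A]

/-- The images of the blocks under an algebra hom `B` multiply out: if `B(ι a_i ∧ ι b_i) = (2 s) • φ_i`
for each `i`, then the product of the `n` block images is `(2 s)^n • (φ_0 ⋯ φ_{n-1})`. -/
theorem prod_ofFn_map_blocks (B : ExteriorAlgebra R M →ₐ[R] A) :
    ∀ {n : ℕ} (a b : Fin n → M) (s : R) (φ : Fin n → A),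
      (∀ i, B (ι R (a i) * ι R (b i)) = (2 * s) • φ i) →
      (List.ofFn fun i => B (ι R (a i) * ι R (b i))).prod = (2 * s) ^ n • (List.ofFn φ).prod
  | 0, _, _, _, _, _ => by simp
  | n + 1, a, b, s, φ, h => by
    rw [List.ofFn_succ, List.ofFn_succ, List.prod_cons, List.prod_cons, h 0,
      prod_ofFn_map_blocks B (fun i => a i.succ) (fun i => b i.succ) s (fun i => φ i.succ)
        (fun i => h i.succ),
      smul_mul_smul_comm, pow_succ']

/-- For an algebra hom `B` (the intertwiner commutes with the outer exterior product) sending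
each block `ι a_i ∧ ι b_i` to `(2 s) • φ_i` — `s = 1` reads the author copy's order of the local
product formula, `s = −1` the print's — the image of `ψ_{n,0} ∧ ψ_{0,n}` is
`(−1)^{n choose 2} (2 s)^n • (φ_0 ⋯ φ_{n-1})`. -/
theorem map_ιMulti_mul_ιMulti_of_blocks (B : ExteriorAlgebra R M →ₐ[R] A) {n : ℕ}
    (a b : Fin n → M) (s : R) (φ : Fin n → A)
    (h : ∀ i, B (ι R (a i) * ι R (b i)) = (2 * s) • φ i) :
    B (ιMulti R n a * ιMulti R n b)
      = ((-1 : R) ^ (n.choose 2) * (2 * s) ^ n) • (List.ofFn φ).prod := by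
  rw [ιMulti_mul_ιMulti_eq_blocks, map_smul, map_list_prod, List.map_ofFn]
  have := prod_ofFn_map_blocks B a b s φ h
  simp only [Function.comp_def] at this ⊢
  rw [this, smul_smul]

/-- The route's `n = 2` with the order convention `s` (`s * s = 1`): whichever order the local
product formula is printed in, `B((ι a ∧ ι c) ∧ (ι b ∧ ι d)) = −4 • (φ₁ φ₂)`. -/
theorem map_four_of_blocks (B : ExteriorAlgebra R M →ₐ[R] A) (a b c d : M) (s : R)
    (hs : s * s = 1) (φ₁ φ₂ : A) (h₁ : B (ι R a * ι R b) = (2 * s) • φ₁)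
    (h₂ : B (ι R c * ι R d) = (2 * s) • φ₂) :
    B ((ι R a * ι R c) * (ι R b * ι R d)) = -((4 : R) • (φ₁ * φ₂)) := by
  rw [reorder_four, map_neg, map_mul, h₁, h₂, smul_mul_smul_comm,
    show (2 * s) * (2 * s) = 4 * (s * s) by ring, hs, mul_one]

/-- The author copy's order (arXiv:1306.1515 Prop. 92): `B(ψ_{1,0} ∧ ψ_{0,1}) = 2 φ` per block
gives `B(ψ_{2,0} ∧ ψ_{0,2}) = −4 φ₁ φ₂`. -/
theorem map_four_of_author_order (B : ExteriorAlgebra R M →ₐ[R] A) (a b c d : M) (φ₁ φ₂ : A)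
    (h₁ : B (ι R a * ι R b) = (2 : R) • φ₁) (h₂ : B (ι R c * ι R d) = (2 : R) • φ₂) :
    B ((ι R a * ι R c) * (ι R b * ι R d)) = -((4 : R) • (φ₁ * φ₂)) :=
  map_four_of_blocks B a b c d 1 (by ring) φ₁ φ₂ (by simpa using h₁) (by simpa using h₂)

/-- The print's order (Acta Math. 216, Prop. C.10): `B(ψ_{0,1} ∧ ψ_{1,0}) = 2 φ` per block gives
the SAME `B(ψ_{2,0} ∧ ψ_{0,2}) = −4 φ₁ φ₂` — the order convention drops out at `n = 2`. -/
theorem map_four_of_print_order (B : ExteriorAlgebra R M →ₐ[R] A) (a b c d : M) (φ₁ φ₂ : A)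
    (h₁ : B (ι R b * ι R a) = (2 : R) • φ₁) (h₂ : B (ι R d * ι R c) = (2 : R) • φ₂) :
    B ((ι R a * ι R c) * (ι R b * ι R d)) = -((4 : R) • (φ₁ * φ₂)) := by
  refine map_four_of_blocks B a b c d (-1) (by ring) φ₁ φ₂ ?_ ?_
  · rw [ι_mul_ι_swap, map_neg, h₁, mul_neg_one, neg_smul]
  · rw [ι_mul_ι_swap, map_neg, h₂, mul_neg_one, neg_smul]

end blocks

end HodgeRepro.T3P1.WedgeReorder

/-!
## Appendix (v2): the same for `q`-fold line-forms, from the graded instance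

BMM's cocycles of the general dual pair have `ψ_{q,0}`, `ψ_{0,q}` of degree `q`; the regrouping of
`n` holomorphic and `n` anti-holomorphic `q`-forms into `n` blocks `(x_i ∧ y_i)` costs
`(−1)^{q·q·C(n,2)}`, and with an algebra hom `B` sending each block to `(c s) • φ_i` (`c = 2^q`,
`s = ±1` the order convention) the image of `ψ_{nq,0} ∧ ψ_{0,nq}` is
`(−1)^{q·q·C(n,2)} (c s)^n • (φ_0 ⋯ φ_{n-1})` — `map_prod_ofFn_of_blocks`.  The literal reading of
the two printed statements is `map_mul_of_swap`: from `B(ψ_{0,q} ∧ ψ_{q,0}) = c • φ` (the print)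
one gets `B(ψ_{q,0} ∧ ψ_{0,q}) = ((−1)^q c) • φ` (`ψ_{q,q}` in the author copy's order).
-/

namespace HodgeRepro.T3P1.WedgeReorder

open ExteriorAlgebra

variable {R : Type*} [CommRing R] {M : Type*} [AddCommGroup M] [Module R M]

/-- The product of `n` elements of `⋀[R]^q M` lies in `⋀[R]^(q n) M`. -/
theorem prod_ofFn_mem_exteriorPower {q : ℕ} :
    ∀ {n : ℕ} (x : Fin n → ExteriorAlgebra R M), (∀ i, x i ∈ ⋀[R]^q M) →
      (List.ofFn x).prod ∈ ⋀[R]^(q * n) M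
  | 0, _, _ => by
    rw [List.ofFn_zero, List.prod_nil, Nat.mul_zero]
    exact SetLike.one_mem_graded (fun i : ℕ => ⋀[R]^i M)
  | n + 1, x, hx => by
    rw [List.ofFn_succ, List.prod_cons, Nat.mul_succ, add_comm]
    exact SetLike.mul_mem_graded (A := fun i : ℕ => ⋀[R]^i M) (hx 0)
      (prod_ofFn_mem_exteriorPower (fun i => x i.succ) (fun i => hx i.succ))

/-- Regrouping `n` holomorphic and `n` anti-holomorphic `q`-forms into `n` blocks `(x_i ∧ y_i)`
costs the sign `(−1)^{q·q·C(n,2)}` (at `q = 1`: `ιMulti_mul_ιMulti_eq_blocks`). -/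
theorem prod_ofFn_mul_prod_ofFn_eq_blocks {q : ℕ} :
    ∀ {n : ℕ} (x y : Fin n → ExteriorAlgebra R M), (∀ i, x i ∈ ⋀[R]^q M) →
      (∀ i, y i ∈ ⋀[R]^q M) →
      (List.ofFn x).prod * (List.ofFn y).prod
        = (-1 : R) ^ (q * q * n.choose 2) • (List.ofFn fun i => x i * y i).prod
  | 0, _, _, _, _ => by simp
  | n + 1, x, y, hx, hy => by
    have hX : (List.ofFn fun i => x i.succ).prod ∈ ⋀[R]^(q * n) M :=
      prod_ofFn_mem_exteriorPower _ (fun i => hx i.succ)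
    have hswap : (List.ofFn fun i => x i.succ).prod * y 0
        = (-1 : R) ^ (q * n * q) • (y 0 * (List.ofFn fun i => x i.succ).prod) :=
      mul_comm_of_mem_exteriorPower hX (hy 0)
    have hexp : q * n * q + q * q * n.choose 2 = q * q * (n + 1).choose 2 := by
      rw [Nat.choose_succ_succ' n 1, Nat.choose_one_right]; ring
    rw [List.ofFn_succ, List.ofFn_succ, List.ofFn_succ, List.prod_cons, List.prod_cons,
      List.prod_cons]
    calc x 0 * (List.ofFn fun i => x i.succ).prod * (y 0 * (List.ofFn fun i => y i.succ).prod)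
        = x 0 * ((List.ofFn fun i => x i.succ).prod * y 0) *
            (List.ofFn fun i => y i.succ).prod := by simp only [mul_assoc]
      _ = (-1 : R) ^ (q * n * q) • ((x 0 * y 0) *
            ((List.ofFn fun i => x i.succ).prod * (List.ofFn fun i => y i.succ).prod)) := by
          rw [hswap, mul_smul_comm, smul_mul_assoc]
          simp only [mul_assoc]
      _ = (-1 : R) ^ (q * n * q) • ((x 0 * y 0) * ((-1 : R) ^ (q * q * n.choose 2) •
            (List.ofFn fun i => x i.succ * y i.succ).prod)) := by
          rw [prod_ofFn_mul_prod_ofFn_eq_blocks (fun i => x i.succ) (fun i => y i.succ)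
            (fun i => hx i.succ) (fun i => hy i.succ)]
      _ = (-1 : R) ^ (q * q * (n + 1).choose 2) •
            (x 0 * y 0 * (List.ofFn fun i => x i.succ * y i.succ).prod) := by
          rw [mul_smul_comm, smul_smul, ← pow_add, hexp]

section blocks

variable {A : Type*} [Ring A] [Algebra R A]

/-- The images of `n` blocks under an algebra hom `B` multiply out: if `B(x_i * y_i) = (c s) • φ_i`
for each `i`, the product of the block images is `(c s)^n • (φ_0 ⋯ φ_{n-1})`. -/
theorem prod_ofFn_map_blocks' (B : ExteriorAlgebra R M →ₐ[R] A) :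
    ∀ {n : ℕ} (x y : Fin n → ExteriorAlgebra R M) (c s : R) (φ : Fin n → A),
      (∀ i, B (x i * y i) = (c * s) • φ i) →
      (List.ofFn fun i => B (x i * y i)).prod = (c * s) ^ n • (List.ofFn φ).prod
  | 0, _, _, _, _, _, _ => by simp
  | n + 1, x, y, c, s, φ, h => by
    rw [List.ofFn_succ, List.ofFn_succ, List.prod_cons, List.prod_cons, h 0,
      prod_ofFn_map_blocks' B (fun i => x i.succ) (fun i => y i.succ) c s (fun i => φ i.succ)
        (fun i => h i.succ),
      smul_mul_smul_comm, pow_succ']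

/-- For an algebra hom `B` sending each block `x_i ∧ y_i` of `q`-forms to `(c s) • φ_i`
(`c = 2^q` the constant of the local product formula, `s = ±1` the order convention), the image
of `(x_0 ∧ ⋯ ∧ x_{n-1}) ∧ (y_0 ∧ ⋯ ∧ y_{n-1})` is `(−1)^{q·q·C(n,2)} (c s)^n • (φ_0 ⋯ φ_{n-1})`. -/
theorem map_prod_ofFn_of_blocks (B : ExteriorAlgebra R M →ₐ[R] A) {q n : ℕ}
    (x y : Fin n → ExteriorAlgebra R M) (hx : ∀ i, x i ∈ ⋀[R]^q M) (hy : ∀ i, y i ∈ ⋀[R]^q M)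
    (c s : R) (φ : Fin n → A) (h : ∀ i, B (x i * y i) = (c * s) • φ i) :
    B ((List.ofFn x).prod * (List.ofFn y).prod)
      = ((-1 : R) ^ (q * q * n.choose 2) * (c * s) ^ n) • (List.ofFn φ).prod := by
  rw [prod_ofFn_mul_prod_ofFn_eq_blocks x y hx hy, map_smul, map_list_prod, List.map_ofFn]
  have := prod_ofFn_map_blocks' B x y c s φ h
  simp only [Function.comp_def] at this ⊢
  rw [this, smul_smul]

/-- The two printed statements of the local product formula, read literally: if
`B(y ∧ x) = c • φ` for `x, y ∈ ⋀[R]^q M` (the print's `B(ψ_{0,q} ∧ ψ_{q,0}) = 2^q φ_{q,q}`), then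
`B(x ∧ y) = ((−1)^q c) • φ` (the author copy's order, `ψ_{q,q} = ψ_{q,0} ∧ ψ_{0,q}`). -/
theorem map_mul_of_swap (B : ExteriorAlgebra R M →ₐ[R] A) {q : ℕ}
    {x y : ExteriorAlgebra R M} (hx : x ∈ ⋀[R]^q M) (hy : y ∈ ⋀[R]^q M) (c : R) (φ : A)
    (h : B (y * x) = c • φ) :
    B (x * y) = ((-1 : R) ^ q * c) • φ := by
  rw [mul_comm_of_mem_exteriorPower_self hx hy, map_smul, h, smul_smul]

end blocks

end HodgeRepro.T3P1.WedgeReorder
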